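import Literature.NumberTheory.ComplexMultiplication.EllipticUnits.ImaginaryQuadraticMainConjectureCarriersOExist
import Literature.NumberTheory.ComplexMultiplication.EllipticUnits.ImaginaryQuadraticMainConjectureCarriersOLevels
import Literature.NumberTheory.EllipticCurves.Rubin1991.TwoVariableMainConjecture
import HarnessLib

/-!
# Sketch — node `tfnorm` (crux-ideate g25 on `stmt-BirchSwinnertonDyer-23599`, stub `stub_frameTF_ns` of `Lines/rtt_w3.lean` v16)

(B1) PROVED: at `γ₂ = 1` the inner variable `T₂ = C X` acts as `0` on EVERY pinned datum ((P6) + `levelConjO_one` + (P3)),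
so `torsionBy (C X) = ⊤`; hence the registered `stub_frameTF_ns` — which quantifies over ALL `γ₂` with no generator
hypothesis — forces `D₁'.H = 0` for every `γ₂ = 1` datum (B1''), i.e. is unprovable as typed (data exist for every `γ₂`,
`nonempty_iwasawaCohomologyDataO`, and `lim← H¹ ≠ 0` by rank one).
(B0) PROVED: the pure-algebra heart of the repair mechanism (Kato §13.8, printed p. 228): a sequence in a `p^k`-torsion group
with `a n = p • a (n+1)` vanishes — "lim← of H⁰ under norms is zero".
(R) STATED: the repaired inner block `FrameTFInner` (generator-pair binder added), the shape LEAD should register in v17.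
BSD / crux L / the stub proved for NO curve.
-/

open scoped NumberField
open Field
open Literature.NumberTheory.ComplexMultiplication.EllipticUnits
open Literature.NumberTheory.ComplexMultiplication.EllipticUnits.JohnsonLeungKings2011
open Literature.NumberTheory.EllipticCurves

set_option linter.dupNamespace false

namespace Summit.BirchSwinnertonDyer.BirchSwinnertonDyer.Cruxes.SmallImageLowerHalfBothSigns.Tfnorm

/-- (B0) **`lim← (A, ×p) = 0` for a `p^k`-torsion group** — the algebra of "the norm maps on the stabilised invariants are
multiplication by `p`, hence `lim←_n H⁰ = 0`" (Kato, Astérisque 295, §13.8, printed p. 228). -/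
theorem eq_zero_of_forall_eq_p_smul {A : Type*} [AddCommGroup A] {p k : ℕ} (hA : ∀ a : A, p ^ k • a = 0)
    (a : ℕ → A) (ha : ∀ n, a n = p • a (n + 1)) (n : ℕ) : a n = 0 := by
  have key : ∀ j m, a m = p ^ j • a (m + j) := by
    intro j
    induction j with
    | zero => intro m; simp
    | succ j ih =>
      intro m
      rw [ih m, ha (m + j), smul_smul, ← pow_succ, ← add_assoc]
  rw [key k n, hA]

variable {K : Type} [Field K] [NumberField K] {p : ℕ} [Fact p.Prime] (S : Set (PadicAlgCl p))
  (κ₁ κ₂ : ZpExtension K p) (γ₁ : absoluteGaloisGroup K)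
  (θ : absoluteGaloisGroup K →ₜ* (padicCoeffIntegers S)ˣ) (𝔣 : Ideal (𝓞 K))

/-- (B1) **Bug witness, proved.** With `γ₂ = 1`, `T₂ = C X ∈ Λ_𝒪` acts as zero on every pinned datum: by (P6)
`proj (C X • x) = conj_1 (proj x) − proj x = 0` (`levelConjO_one`), and (P3) joint injectivity. -/
theorem C_X_smul_eq_zero_of_gamma₂_eq_one {i : ℕ} (D : IwasawaCohomologyDataO S κ₁ κ₂ γ₁ 1 θ 𝔣 i) (x : D.H) :
    (PowerSeries.C (PowerSeries.X : PowerSeries (padicCoeffIntegers S)) : IwasawaAlgebraO₂ S) • x = 0 :=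
  D.proj_injective _ fun n k ↦ by
    rw [D.proj_T₂_smul]
    show levelConjO S (suppPF p 𝔣) θ (JohnsonLeungKings2011.pairLayerSubgroup κ₁ κ₂ n) k i 1 (D.proj n k x) - D.proj n k x = 0
    rw [levelConjO_one, sub_self]

/-- (B1') Hence the `(C X)`-torsion submodule is EVERYTHING at `γ₂ = 1` (the stub asserts it is `⊥`). -/
theorem torsionBy_C_X_eq_top_of_gamma₂_eq_one {i : ℕ} (D : IwasawaCohomologyDataO S κ₁ κ₂ γ₁ 1 θ 𝔣 i) :
    Submodule.torsionBy (IwasawaAlgebraO₂ S) D.H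
      (PowerSeries.C (PowerSeries.X - PowerSeries.C (0 : padicCoeffIntegers S) : PowerSeries (padicCoeffIntegers S)) :
        IwasawaAlgebraO₂ S) = ⊤ := by
  rw [eq_top_iff]
  intro x _
  rw [Submodule.mem_torsionBy_iff, map_zero, sub_zero]
  exact C_X_smul_eq_zero_of_gamma₂_eq_one S κ₁ κ₂ γ₁ θ 𝔣 D x

/-- (B1'') **The registered shape forces `H = 0` at `γ₂ = 1`.** The final block of `stub_frameTF_ns` (v16, ll. 553–558),
read at `γ₂ := 1`, says `torsionBy (C (X − C 0)) = ⊥`; with (B1') this is `⊤ = ⊥`, i.e. every element of `D.H` is `0`. -/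
theorem forall_eq_zero_of_stubShape_at_one {i : ℕ} (D : IwasawaCohomologyDataO S κ₁ κ₂ γ₁ 1 θ 𝔣 i)
    (h : Submodule.torsionBy (IwasawaAlgebraO₂ S) D.H
      (PowerSeries.C (PowerSeries.X - PowerSeries.C (0 : padicCoeffIntegers S) : PowerSeries (padicCoeffIntegers S)) :
        IwasawaAlgebraO₂ S) = ⊥) (x : D.H) : x = 0 := by
  have hx : x ∈ Submodule.torsionBy (IwasawaAlgebraO₂ S) D.H
      (PowerSeries.C (PowerSeries.X - PowerSeries.C (0 : padicCoeffIntegers S) : PowerSeries (padicCoeffIntegers S)) :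
        IwasawaAlgebraO₂ S) := by
    rw [torsionBy_C_X_eq_top_of_gamma₂_eq_one]; trivial
  rw [h] at hx
  exact (Submodule.mem_bot _).mp hx

/-- (R) **The REPAIRED inner block of `stub_frameTF_ns`** (what v17 should register in place of ll. 553–558): the
generator-pair binder `IsTopGeneratorPair (κ₁.unitTwist u₁) (κ₂.unitTwist u₂) γ₁ γ₂` — exactly the binder
`stub_frameTors_ns` carried and the consumer `stub_charRoadFrame_ns_of₂` already holds as `hpair` — is ADDED; then
"`𝐇¹` has no `(γ₂ − 1)`-torsion" is a theorem of the `ℤ_p²`-tower (image of `H⁰_Iw` of the complementary `ℤ_p`-tower,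
which is `lim←` of stabilised invariants under norms `= ×p`, hence `0`). -/
def FrameTFInner : Prop :=
  ∀ (κ₂' : ZpExtension K p) (γ₂ : absoluteGaloisGroup K) (u₁ u₂ : ℤ_[p]ˣ),
    ZpExtension.IsTopGeneratorPair (κ₁.unitTwist u₁) (κ₂'.unitTwist u₂) γ₁ γ₂ →
    ∀ (𝔣' : Ideal (𝓞 K)) (θ' : absoluteGaloisGroup K →ₜ* (padicCoeffIntegers S)ˣ)
      (D : IwasawaCohomologyDataO S κ₁ κ₂' γ₁ γ₂ θ' 𝔣' 1),
      Submodule.torsionBy (IwasawaAlgebraO₂ S) D.H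
        (PowerSeries.C (PowerSeries.X - PowerSeries.C (0 : padicCoeffIntegers S) : PowerSeries (padicCoeffIntegers S)) :
          IwasawaAlgebraO₂ S) = ⊥

/-- (B2) **First brick of the levelwise proof of (R)** (statement; one generation): a `γ₂`-FIXED element of the pinned
`H^i` has level components killed by `p^{?}`-fold… — precisely: if `conj_{γ₂}` fixes `x`, then for every `n, k` the
component `proj n k x` is the corestriction from level `n + k` of a class whose RESTRICTION back to level `n + k` is
`p^k • (…) = 0` (`res ∘ cor = Σ conj`, `resLe_coresLe_eq_sum_conjMap`; uniform `p^k`-torsion `levelCohO_torsion`).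
Typed here in its cheapest consequence used downstream: `T₂ • x = 0 → ∀ n k, p ^ k • proj n k x = 0` is free, the
content is the norm identity, which needs the tree's `resLe` on `levelRepO`; we record the target shape over `proj`. -/
def FirstBrickShape {i : ℕ} (γ₂ : absoluteGaloisGroup K) (D : IwasawaCohomologyDataO S κ₁ κ₂ γ₁ γ₂ θ 𝔣 i) : Prop :=
  ∀ x : D.H, (PowerSeries.C (PowerSeries.X : PowerSeries (padicCoeffIntegers S)) : IwasawaAlgebraO₂ S) • x = 0 →
    ∀ n k : ℕ, layerConjO S κ₁ κ₂ θ 𝔣 n k i γ₂ (D.proj n k x) = D.proj n k x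

/-- (B2 is indeed free from (P6): recorded so the hand starts from `conj_{γ₂} y = y` levelwise.) -/
theorem firstBrickShape_holds {i : ℕ} (γ₂ : absoluteGaloisGroup K) (D : IwasawaCohomologyDataO S κ₁ κ₂ γ₁ γ₂ θ 𝔣 i) :
    FirstBrickShape S κ₁ κ₂ γ₁ θ 𝔣 γ₂ D := by
  intro x hx n k
  have h := D.proj_T₂_smul n k x
  rw [hx, map_zero] at h
  exact (sub_eq_zero.mp h.symm)

end Summit.BirchSwinnertonDyer.BirchSwinnertonDyer.Cruxes.SmallImageLowerHalfBothSigns.Tfnorm
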